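import Mathlib
import HarnessLib
import Literature.MathematicalPhysics.KineticTheory.HardSphereEulerProofs
import Summits.AtomisticToContinuum.HydrodynamicLimit.Theses.OneFlightGossipEngine
import Summits.AtomisticToContinuum.HydrodynamicLimit.Theorems.OneFlightGossipEngineKineticCurrentsLDAlongFamiliesFamilyModulus
import Summits.AtomisticToContinuum.HydrodynamicLimit.Theorems.OneFlightGossipEngineKineticCurrentsLDAlongFamiliesLawChange
import Summits.AtomisticToContinuum.HydrodynamicLimit.Theorems.OneFlightGossipEngineKineticCurrentsLDAlongFamiliesRadialTailDominator
import Summits.AtomisticToContinuum.HydrodynamicLimit.Theorems.OneFlightGossipEngineKineticCurrentsLDAlongFamiliesRadialTailsAt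
import Summits.AtomisticToContinuum.HydrodynamicLimit.Theorems.OneFlightGossipEngineKineticCurrentsLDAlongFamiliesWindowTailsFamilyOfPointwise
import Summits.AtomisticToContinuum.HydrodynamicLimit.Theorems.OneFlightGossipEngineKineticCurrentsLDAlongFamiliesTransferByNetsEv
import Summits.AtomisticToContinuum.HydrodynamicLimit.Theorems.OneFlightGossipEngineKineticCurrentsLDAlongFamiliesKCWUSharpImpliesRung

/-!
# The crux `KineticCurrentsLDAlongFamilies` (stmt-AtomisticToContinuum-16659) modulo ONE pointwise rung:
# `KCWUSharpPlus` — line `Sketch`, skeleton v5 (radial reshape), lead prover-line-…-16659-c2-0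

Route `OneFlightGossipEngine`, sub-problem `HydrodynamicLimit`. Certificates for the planner (all sorry-free):

* `stub_crux_of_kcwuSharp_of_kcwuSharpRadial` — the v5 composition of line `Sketch`
  with its two OPEN stubs as hypotheses: the family crux follows from the pointwise rung with a numeric tilt
  threshold for the structured class (S1 `stub_kcwuSharp`) and for its radial sector (S1R
  `stub_kcwuSharpRadial`), everything else being the landed statics (S8 p136419, S10 p136745, S9 p137070,
  S7' p137211, S5 p129139, S6 p128108).
* `kcwuSharp_of_kcwuSharpPlus`, `kcwuSharpRadial_of_kcwuSharpPlus` — both open stubs are instances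
  (`K = 0`, resp. `A = 0, b = 0, G = 0`) of ONE statement, `KCWUSharpPlus`: the pointwise kinetic-window LD
  rung with numeric `β₀(Θ,U,C,Λ,σ)` for the class `A(x):w⊗w + (b(x)·w)G(x,|w|²) + K(x,|w|²)`
  (`w = v − u₀(x)`; growth `C(1+‖v‖²)`; `⊥ 1, v_j, ‖v‖²` under `M_{1,u₀(x),θ₀(x)}` at every `x`).
* `stub_kcwuSharpPlus_implies_crux` — hence crux 16659 ⟸ `KCWUSharpPlus` ALONE, and
  `kineticCurrentsWindowLDUniform_of_kcwuSharpPlus` — `KCWUSharpPlus` ⟹ the support rung 14662 (via p134390),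
  so the single statement to file is sandwiched: 14662 ⟸ 16659 ⟸ KCWUSharpPlus ⟹ 14662-sharp.

`KCWUSharpPlus` is written UNFOLDED as a hypothesis (no new definition); it is research-level (kinetic
relaxation of non-hydrodynamic one-body modes at LD scale over `τ ≫ 1` mean free times for deterministic
hard spheres at fixed reduced density) and is NOT claimed here.
-/

noncomputable section

open MeasureTheory Set Filter
open scoped ENNReal Topology

namespace Summit.AtomisticToContinuum.HydrodynamicLimit.Theorems.KineticCurrentsLDAlongFamiliesSketch

open Literature.Analysis.FluidPDE (HardSphereFlow Config localMaxwellian canonicalDensity liouville)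
open Literature.MathematicalPhysics.KineticTheory (T3 V3 hsDiameter localGibbsLaw localGibbsMeasure
  localGibbsProfile)
open Literature.Analysis.FluidPDE Literature.MathematicalPhysics.KineticTheory
open Summit.AtomisticToContinuum.HydrodynamicLimit.Theses.OneFlightGossipEngine
  (KineticCurrentsLDAlongFamilies KineticCurrentsWindowLDUniform)

/-- **Crux 16659 from its two open pointwise rungs** (the v5 composition of line `Sketch`, hypotheses = the registered open stubs S1 `stub_kcwuSharp` and S1R `stub_kcwuSharpRadial`; all other stubs landed). [folklore] -/
theorem stub_crux_of_kcwuSharp_of_kcwuSharpRadial :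
    (∃ η₀ : ℝ, 0 < η₀ ∧ ∀ (Θ U C Λ : ℝ), 1 ≤ Θ → 0 ≤ U → 0 ≤ C → 1 ≤ Λ → ∀ σ : ℝ, 0 < σ →
        ∃ β₀ : ℝ, 0 < β₀ ∧
        ∀ (a θ₀ : T3 → ℝ) (u₀ : T3 → V3), Continuous a → Continuous θ₀ → Continuous u₀ →
        (∀ x, Λ⁻¹ ≤ a x ∧ a x ≤ Λ) → (∀ x, Θ⁻¹ ≤ θ₀ x ∧ θ₀ x ≤ Θ) → (∀ x, ‖u₀ x‖ ≤ U) →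
        σ ^ 3 * (⨆ x, a x) ≤ η₀ * ∫ x, a x →
        ∀ Φ : (N : ℕ) →
          HardSphereFlow (Torus.geometry (Fin 3)) (hsDiameter σ N) (N + 1),
        ∀ (A : T3 → Fin 3 → Fin 3 → ℝ) (b : T3 → V3) (G : T3 × ℝ → ℝ),
        Continuous A → Continuous b → Continuous G →
        ∀ F : T3 × V3 → ℝ, (∀ y, F y =
          (∑ j : Fin 3, ∑ k : Fin 3, A y.1 j k * ((y.2 - u₀ y.1) j * (y.2 - u₀ y.1) k)) +
            (∑ j : Fin 3, b y.1 j * (y.2 - u₀ y.1) j) * G (y.1, ‖y.2 - u₀ y.1‖ ^ 2)) →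
        (∀ y, |F y| ≤ C * (1 + ‖y.2‖ ^ 2)) →
        (∀ x, ∫ v, F (x, v) * localMaxwellian 1 (θ₀ x) (u₀ x) v = 0) →
        (∀ x (j : Fin 3), ∫ v, F (x, v) * v j * localMaxwellian 1 (θ₀ x) (u₀ x) v = 0) →
        (∀ x, ∫ v, F (x, v) * ‖v‖ ^ 2 * localMaxwellian 1 (θ₀ x) (u₀ x) v = 0) →
        ∀ β : ℝ, |β| ≤ β₀ → ∀ ε : ℝ, 0 < ε → ∃ τ₀ : ℝ, 0 < τ₀ ∧ ∀ τ : ℝ, τ₀ ≤ τ →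
        ∃ N₀ : ℕ, ∀ N : ℕ, N₀ ≤ N →
          ∫⁻ z, ENNReal.ofReal (Real.exp (β * ∑ i : Fin (N + 1),
              (τ * ((N : ℝ) + 1) ^ (-(1 / 3 : ℝ)))⁻¹ *
                ∫ r in (0 : ℝ)..(τ * ((N : ℝ) + 1) ^ (-(1 / 3 : ℝ))), F (((Φ N).flow r z) i)))
            ∂(localGibbsLaw σ a u₀ θ₀ N (Φ N)) ≤
          ENNReal.ofReal (Real.exp (ε * ((N : ℝ) + 1)))) →
    (∃ η₀ : ℝ, 0 < η₀ ∧ ∀ (Θ U C Λ : ℝ), 1 ≤ Θ → 0 ≤ U → 0 ≤ C → 1 ≤ Λ → ∀ σ : ℝ, 0 < σ →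
        ∃ β₀ : ℝ, 0 < β₀ ∧
        ∀ (a θ₀ : T3 → ℝ) (u₀ : T3 → V3), Continuous a → Continuous θ₀ → Continuous u₀ →
        (∀ x, Λ⁻¹ ≤ a x ∧ a x ≤ Λ) → (∀ x, Θ⁻¹ ≤ θ₀ x ∧ θ₀ x ≤ Θ) → (∀ x, ‖u₀ x‖ ≤ U) →
        σ ^ 3 * (⨆ x, a x) ≤ η₀ * ∫ x, a x →
        ∀ Φ : (N : ℕ) → HardSphereFlow (Torus.geometry (Fin 3)) (hsDiameter σ N) (N + 1),
        ∀ K : T3 × ℝ → ℝ, Continuous K →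
        ∀ F : T3 × V3 → ℝ, (∀ y, F y = K (y.1, ‖y.2 - u₀ y.1‖ ^ 2)) →
        (∀ y, |F y| ≤ C * (1 + ‖y.2‖ ^ 2)) →
        (∀ x, ∫ v, F (x, v) * localMaxwellian 1 (θ₀ x) (u₀ x) v = 0) →
        (∀ x (j : Fin 3), ∫ v, F (x, v) * v j * localMaxwellian 1 (θ₀ x) (u₀ x) v = 0) →
        (∀ x, ∫ v, F (x, v) * ‖v‖ ^ 2 * localMaxwellian 1 (θ₀ x) (u₀ x) v = 0) →
        ∀ β : ℝ, |β| ≤ β₀ → ∀ ε : ℝ, 0 < ε → ∃ τ₀ : ℝ, 0 < τ₀ ∧ ∀ τ : ℝ, τ₀ ≤ τ →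
        ∃ N₀ : ℕ, ∀ N : ℕ, N₀ ≤ N →
          ∫⁻ z, ENNReal.ofReal (Real.exp (β * ∑ i : Fin (N + 1),
              (τ * ((N : ℝ) + 1) ^ (-(1 / 3 : ℝ)))⁻¹ *
                ∫ r in (0 : ℝ)..(τ * ((N : ℝ) + 1) ^ (-(1 / 3 : ℝ))), F (((Φ N).flow r z) i)))
            ∂(localGibbsLaw σ a u₀ θ₀ N (Φ N)) ≤
          ENNReal.ofReal (Real.exp (ε * ((N : ℝ) + 1)))) →
    KineticCurrentsLDAlongFamilies := fun hK hKR =>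
  stub_transferByNetsEv hK
    (stub_windowTailsFamily_of_pointwise (stub_radialTailsAt hKR stub_radialTailDominator)
      stub_lawChangeFamily stub_familyModulus)
    stub_lawChangeFamily stub_familyModulus

/-- **`KCWUSharpPlus ⟹ KCWUSharp`** (S1 is the instance `K = 0` of the rung for the enlarged class). [folklore] -/
theorem kcwuSharp_of_kcwuSharpPlus :
    (∃ η₀ : ℝ, 0 < η₀ ∧ ∀ (Θ U C Λ : ℝ), 1 ≤ Θ → 0 ≤ U → 0 ≤ C → 1 ≤ Λ → ∀ σ : ℝ, 0 < σ →
        ∃ β₀ : ℝ, 0 < β₀ ∧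
        ∀ (a θ₀ : T3 → ℝ) (u₀ : T3 → V3), Continuous a → Continuous θ₀ → Continuous u₀ →
        (∀ x, Λ⁻¹ ≤ a x ∧ a x ≤ Λ) → (∀ x, Θ⁻¹ ≤ θ₀ x ∧ θ₀ x ≤ Θ) → (∀ x, ‖u₀ x‖ ≤ U) →
        σ ^ 3 * (⨆ x, a x) ≤ η₀ * ∫ x, a x →
        ∀ Φ : (N : ℕ) →
          HardSphereFlow (Torus.geometry (Fin 3)) (hsDiameter σ N) (N + 1),
        ∀ (A : T3 → Fin 3 → Fin 3 → ℝ) (b : T3 → V3) (G K : T3 × ℝ → ℝ),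
        Continuous A → Continuous b → Continuous G → Continuous K →
        ∀ F : T3 × V3 → ℝ, (∀ y, F y =
          (∑ j : Fin 3, ∑ k : Fin 3, A y.1 j k * ((y.2 - u₀ y.1) j * (y.2 - u₀ y.1) k)) +
            (∑ j : Fin 3, b y.1 j * (y.2 - u₀ y.1) j) * G (y.1, ‖y.2 - u₀ y.1‖ ^ 2) +
            K (y.1, ‖y.2 - u₀ y.1‖ ^ 2)) →
        (∀ y, |F y| ≤ C * (1 + ‖y.2‖ ^ 2)) →
        (∀ x, ∫ v, F (x, v) * localMaxwellian 1 (θ₀ x) (u₀ x) v = 0) →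
        (∀ x (j : Fin 3), ∫ v, F (x, v) * v j * localMaxwellian 1 (θ₀ x) (u₀ x) v = 0) →
        (∀ x, ∫ v, F (x, v) * ‖v‖ ^ 2 * localMaxwellian 1 (θ₀ x) (u₀ x) v = 0) →
        ∀ β : ℝ, |β| ≤ β₀ → ∀ ε : ℝ, 0 < ε → ∃ τ₀ : ℝ, 0 < τ₀ ∧ ∀ τ : ℝ, τ₀ ≤ τ →
        ∃ N₀ : ℕ, ∀ N : ℕ, N₀ ≤ N →
          ∫⁻ z, ENNReal.ofReal (Real.exp (β * ∑ i : Fin (N + 1),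
              (τ * ((N : ℝ) + 1) ^ (-(1 / 3 : ℝ)))⁻¹ *
                ∫ r in (0 : ℝ)..(τ * ((N : ℝ) + 1) ^ (-(1 / 3 : ℝ))), F (((Φ N).flow r z) i)))
            ∂(localGibbsLaw σ a u₀ θ₀ N (Φ N)) ≤
          ENNReal.ofReal (Real.exp (ε * ((N : ℝ) + 1)))) →
    ∃ η₀ : ℝ, 0 < η₀ ∧ ∀ (Θ U C Λ : ℝ), 1 ≤ Θ → 0 ≤ U → 0 ≤ C → 1 ≤ Λ → ∀ σ : ℝ, 0 < σ →
        ∃ β₀ : ℝ, 0 < β₀ ∧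
        ∀ (a θ₀ : T3 → ℝ) (u₀ : T3 → V3), Continuous a → Continuous θ₀ → Continuous u₀ →
        (∀ x, Λ⁻¹ ≤ a x ∧ a x ≤ Λ) → (∀ x, Θ⁻¹ ≤ θ₀ x ∧ θ₀ x ≤ Θ) → (∀ x, ‖u₀ x‖ ≤ U) →
        σ ^ 3 * (⨆ x, a x) ≤ η₀ * ∫ x, a x →
        ∀ Φ : (N : ℕ) →
          HardSphereFlow (Torus.geometry (Fin 3)) (hsDiameter σ N) (N + 1),
        ∀ (A : T3 → Fin 3 → Fin 3 → ℝ) (b : T3 → V3) (G : T3 × ℝ → ℝ),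
        Continuous A → Continuous b → Continuous G →
        ∀ F : T3 × V3 → ℝ, (∀ y, F y =
          (∑ j : Fin 3, ∑ k : Fin 3, A y.1 j k * ((y.2 - u₀ y.1) j * (y.2 - u₀ y.1) k)) +
            (∑ j : Fin 3, b y.1 j * (y.2 - u₀ y.1) j) * G (y.1, ‖y.2 - u₀ y.1‖ ^ 2)) →
        (∀ y, |F y| ≤ C * (1 + ‖y.2‖ ^ 2)) →
        (∀ x, ∫ v, F (x, v) * localMaxwellian 1 (θ₀ x) (u₀ x) v = 0) →
        (∀ x (j : Fin 3), ∫ v, F (x, v) * v j * localMaxwellian 1 (θ₀ x) (u₀ x) v = 0) →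
        (∀ x, ∫ v, F (x, v) * ‖v‖ ^ 2 * localMaxwellian 1 (θ₀ x) (u₀ x) v = 0) →
        ∀ β : ℝ, |β| ≤ β₀ → ∀ ε : ℝ, 0 < ε → ∃ τ₀ : ℝ, 0 < τ₀ ∧ ∀ τ : ℝ, τ₀ ≤ τ →
        ∃ N₀ : ℕ, ∀ N : ℕ, N₀ ≤ N →
          ∫⁻ z, ENNReal.ofReal (Real.exp (β * ∑ i : Fin (N + 1),
              (τ * ((N : ℝ) + 1) ^ (-(1 / 3 : ℝ)))⁻¹ *
                ∫ r in (0 : ℝ)..(τ * ((N : ℝ) + 1) ^ (-(1 / 3 : ℝ))), F (((Φ N).flow r z) i)))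
            ∂(localGibbsLaw σ a u₀ θ₀ N (Φ N)) ≤
          ENNReal.ofReal (Real.exp (ε * ((N : ℝ) + 1))) := by
  rintro ⟨η₀, hη₀, h⟩
  refine ⟨η₀, hη₀, fun Θ U C Λ hΘ hU hC hΛ σ hσ => ?_⟩
  obtain ⟨β₀, hβ₀, h1⟩ := h Θ U C Λ hΘ hU hC hΛ σ hσ
  refine ⟨β₀, hβ₀, fun a θ₀ u₀ ha hθ hu hab hθb hub hg Φ A b G hA hb hG F hF => ?_⟩
  exact h1 a θ₀ u₀ ha hθ hu hab hθb hub hg Φ A b G (fun _ => 0) hA hb hG continuous_const F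
    (fun y => by rw [hF y, add_zero])

/-- **`KCWUSharpPlus ⟹ KCWUSharpRadial`** (S1R is the instance `A = 0, b = 0, G = 0`). [folklore] -/
theorem kcwuSharpRadial_of_kcwuSharpPlus :
    (∃ η₀ : ℝ, 0 < η₀ ∧ ∀ (Θ U C Λ : ℝ), 1 ≤ Θ → 0 ≤ U → 0 ≤ C → 1 ≤ Λ → ∀ σ : ℝ, 0 < σ →
        ∃ β₀ : ℝ, 0 < β₀ ∧
        ∀ (a θ₀ : T3 → ℝ) (u₀ : T3 → V3), Continuous a → Continuous θ₀ → Continuous u₀ →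
        (∀ x, Λ⁻¹ ≤ a x ∧ a x ≤ Λ) → (∀ x, Θ⁻¹ ≤ θ₀ x ∧ θ₀ x ≤ Θ) → (∀ x, ‖u₀ x‖ ≤ U) →
        σ ^ 3 * (⨆ x, a x) ≤ η₀ * ∫ x, a x →
        ∀ Φ : (N : ℕ) →
          HardSphereFlow (Torus.geometry (Fin 3)) (hsDiameter σ N) (N + 1),
        ∀ (A : T3 → Fin 3 → Fin 3 → ℝ) (b : T3 → V3) (G K : T3 × ℝ → ℝ),
        Continuous A → Continuous b → Continuous G → Continuous K →
        ∀ F : T3 × V3 → ℝ, (∀ y, F y =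
          (∑ j : Fin 3, ∑ k : Fin 3, A y.1 j k * ((y.2 - u₀ y.1) j * (y.2 - u₀ y.1) k)) +
            (∑ j : Fin 3, b y.1 j * (y.2 - u₀ y.1) j) * G (y.1, ‖y.2 - u₀ y.1‖ ^ 2) +
            K (y.1, ‖y.2 - u₀ y.1‖ ^ 2)) →
        (∀ y, |F y| ≤ C * (1 + ‖y.2‖ ^ 2)) →
        (∀ x, ∫ v, F (x, v) * localMaxwellian 1 (θ₀ x) (u₀ x) v = 0) →
        (∀ x (j : Fin 3), ∫ v, F (x, v) * v j * localMaxwellian 1 (θ₀ x) (u₀ x) v = 0) →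
        (∀ x, ∫ v, F (x, v) * ‖v‖ ^ 2 * localMaxwellian 1 (θ₀ x) (u₀ x) v = 0) →
        ∀ β : ℝ, |β| ≤ β₀ → ∀ ε : ℝ, 0 < ε → ∃ τ₀ : ℝ, 0 < τ₀ ∧ ∀ τ : ℝ, τ₀ ≤ τ →
        ∃ N₀ : ℕ, ∀ N : ℕ, N₀ ≤ N →
          ∫⁻ z, ENNReal.ofReal (Real.exp (β * ∑ i : Fin (N + 1),
              (τ * ((N : ℝ) + 1) ^ (-(1 / 3 : ℝ)))⁻¹ *
                ∫ r in (0 : ℝ)..(τ * ((N : ℝ) + 1) ^ (-(1 / 3 : ℝ))), F (((Φ N).flow r z) i)))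
            ∂(localGibbsLaw σ a u₀ θ₀ N (Φ N)) ≤
          ENNReal.ofReal (Real.exp (ε * ((N : ℝ) + 1)))) →
    ∃ η₀ : ℝ, 0 < η₀ ∧ ∀ (Θ U C Λ : ℝ), 1 ≤ Θ → 0 ≤ U → 0 ≤ C → 1 ≤ Λ → ∀ σ : ℝ, 0 < σ →
        ∃ β₀ : ℝ, 0 < β₀ ∧
        ∀ (a θ₀ : T3 → ℝ) (u₀ : T3 → V3), Continuous a → Continuous θ₀ → Continuous u₀ →
        (∀ x, Λ⁻¹ ≤ a x ∧ a x ≤ Λ) → (∀ x, Θ⁻¹ ≤ θ₀ x ∧ θ₀ x ≤ Θ) → (∀ x, ‖u₀ x‖ ≤ U) →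
        σ ^ 3 * (⨆ x, a x) ≤ η₀ * ∫ x, a x →
        ∀ Φ : (N : ℕ) → HardSphereFlow (Torus.geometry (Fin 3)) (hsDiameter σ N) (N + 1),
        ∀ K : T3 × ℝ → ℝ, Continuous K →
        ∀ F : T3 × V3 → ℝ, (∀ y, F y = K (y.1, ‖y.2 - u₀ y.1‖ ^ 2)) →
        (∀ y, |F y| ≤ C * (1 + ‖y.2‖ ^ 2)) →
        (∀ x, ∫ v, F (x, v) * localMaxwellian 1 (θ₀ x) (u₀ x) v = 0) →
        (∀ x (j : Fin 3), ∫ v, F (x, v) * v j * localMaxwellian 1 (θ₀ x) (u₀ x) v = 0) →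
        (∀ x, ∫ v, F (x, v) * ‖v‖ ^ 2 * localMaxwellian 1 (θ₀ x) (u₀ x) v = 0) →
        ∀ β : ℝ, |β| ≤ β₀ → ∀ ε : ℝ, 0 < ε → ∃ τ₀ : ℝ, 0 < τ₀ ∧ ∀ τ : ℝ, τ₀ ≤ τ →
        ∃ N₀ : ℕ, ∀ N : ℕ, N₀ ≤ N →
          ∫⁻ z, ENNReal.ofReal (Real.exp (β * ∑ i : Fin (N + 1),
              (τ * ((N : ℝ) + 1) ^ (-(1 / 3 : ℝ)))⁻¹ *
                ∫ r in (0 : ℝ)..(τ * ((N : ℝ) + 1) ^ (-(1 / 3 : ℝ))), F (((Φ N).flow r z) i)))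
            ∂(localGibbsLaw σ a u₀ θ₀ N (Φ N)) ≤
          ENNReal.ofReal (Real.exp (ε * ((N : ℝ) + 1))) := by
  rintro ⟨η₀, hη₀, h⟩
  refine ⟨η₀, hη₀, fun Θ U C Λ hΘ hU hC hΛ σ hσ => ?_⟩
  obtain ⟨β₀, hβ₀, h1⟩ := h Θ U C Λ hΘ hU hC hΛ σ hσ
  refine ⟨β₀, hβ₀, fun a θ₀ u₀ ha hθ hu hab hθb hub hg Φ K hK F hF => ?_⟩
  exact h1 a θ₀ u₀ ha hθ hu hab hθb hub hg Φ (fun _ _ _ => 0) (fun _ => 0) (fun _ => 0) K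
    continuous_const continuous_const continuous_const hK F (fun y => by simp [hF y])

/-- **Crux 16659 ⟸ `KCWUSharpPlus` alone**: the family-uniform kinetic-window LD bound for the structured class follows from the pointwise rung with numeric tilt threshold for the class enlarged by its radial sector; everything else is landed statics of line `Sketch` (v5). [folklore] -/
theorem stub_kcwuSharpPlus_implies_crux :
    (∃ η₀ : ℝ, 0 < η₀ ∧ ∀ (Θ U C Λ : ℝ), 1 ≤ Θ → 0 ≤ U → 0 ≤ C → 1 ≤ Λ → ∀ σ : ℝ, 0 < σ →
        ∃ β₀ : ℝ, 0 < β₀ ∧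
        ∀ (a θ₀ : T3 → ℝ) (u₀ : T3 → V3), Continuous a → Continuous θ₀ → Continuous u₀ →
        (∀ x, Λ⁻¹ ≤ a x ∧ a x ≤ Λ) → (∀ x, Θ⁻¹ ≤ θ₀ x ∧ θ₀ x ≤ Θ) → (∀ x, ‖u₀ x‖ ≤ U) →
        σ ^ 3 * (⨆ x, a x) ≤ η₀ * ∫ x, a x →
        ∀ Φ : (N : ℕ) →
          HardSphereFlow (Torus.geometry (Fin 3)) (hsDiameter σ N) (N + 1),
        ∀ (A : T3 → Fin 3 → Fin 3 → ℝ) (b : T3 → V3) (G K : T3 × ℝ → ℝ),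
        Continuous A → Continuous b → Continuous G → Continuous K →
        ∀ F : T3 × V3 → ℝ, (∀ y, F y =
          (∑ j : Fin 3, ∑ k : Fin 3, A y.1 j k * ((y.2 - u₀ y.1) j * (y.2 - u₀ y.1) k)) +
            (∑ j : Fin 3, b y.1 j * (y.2 - u₀ y.1) j) * G (y.1, ‖y.2 - u₀ y.1‖ ^ 2) +
            K (y.1, ‖y.2 - u₀ y.1‖ ^ 2)) →
        (∀ y, |F y| ≤ C * (1 + ‖y.2‖ ^ 2)) →
        (∀ x, ∫ v, F (x, v) * localMaxwellian 1 (θ₀ x) (u₀ x) v = 0) →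
        (∀ x (j : Fin 3), ∫ v, F (x, v) * v j * localMaxwellian 1 (θ₀ x) (u₀ x) v = 0) →
        (∀ x, ∫ v, F (x, v) * ‖v‖ ^ 2 * localMaxwellian 1 (θ₀ x) (u₀ x) v = 0) →
        ∀ β : ℝ, |β| ≤ β₀ → ∀ ε : ℝ, 0 < ε → ∃ τ₀ : ℝ, 0 < τ₀ ∧ ∀ τ : ℝ, τ₀ ≤ τ →
        ∃ N₀ : ℕ, ∀ N : ℕ, N₀ ≤ N →
          ∫⁻ z, ENNReal.ofReal (Real.exp (β * ∑ i : Fin (N + 1),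
              (τ * ((N : ℝ) + 1) ^ (-(1 / 3 : ℝ)))⁻¹ *
                ∫ r in (0 : ℝ)..(τ * ((N : ℝ) + 1) ^ (-(1 / 3 : ℝ))), F (((Φ N).flow r z) i)))
            ∂(localGibbsLaw σ a u₀ θ₀ N (Φ N)) ≤
          ENNReal.ofReal (Real.exp (ε * ((N : ℝ) + 1)))) →
    KineticCurrentsLDAlongFamilies := fun h =>
  stub_crux_of_kcwuSharp_of_kcwuSharpRadial (kcwuSharp_of_kcwuSharpPlus h)
    (kcwuSharpRadial_of_kcwuSharpPlus h)

/-- **`KCWUSharpPlus ⟹` the support rung 14662** `KineticCurrentsWindowLDUniform` (through S1 and the landed certificate `stub_kcwuSharp_implies_rung`, p134390): the statement to file is 14662-sharp. [folklore] -/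
theorem kineticCurrentsWindowLDUniform_of_kcwuSharpPlus :
    (∃ η₀ : ℝ, 0 < η₀ ∧ ∀ (Θ U C Λ : ℝ), 1 ≤ Θ → 0 ≤ U → 0 ≤ C → 1 ≤ Λ → ∀ σ : ℝ, 0 < σ →
        ∃ β₀ : ℝ, 0 < β₀ ∧
        ∀ (a θ₀ : T3 → ℝ) (u₀ : T3 → V3), Continuous a → Continuous θ₀ → Continuous u₀ →
        (∀ x, Λ⁻¹ ≤ a x ∧ a x ≤ Λ) → (∀ x, Θ⁻¹ ≤ θ₀ x ∧ θ₀ x ≤ Θ) → (∀ x, ‖u₀ x‖ ≤ U) →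
        σ ^ 3 * (⨆ x, a x) ≤ η₀ * ∫ x, a x →
        ∀ Φ : (N : ℕ) →
          HardSphereFlow (Torus.geometry (Fin 3)) (hsDiameter σ N) (N + 1),
        ∀ (A : T3 → Fin 3 → Fin 3 → ℝ) (b : T3 → V3) (G K : T3 × ℝ → ℝ),
        Continuous A → Continuous b → Continuous G → Continuous K →
        ∀ F : T3 × V3 → ℝ, (∀ y, F y =
          (∑ j : Fin 3, ∑ k : Fin 3, A y.1 j k * ((y.2 - u₀ y.1) j * (y.2 - u₀ y.1) k)) +
            (∑ j : Fin 3, b y.1 j * (y.2 - u₀ y.1) j) * G (y.1, ‖y.2 - u₀ y.1‖ ^ 2) +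
            K (y.1, ‖y.2 - u₀ y.1‖ ^ 2)) →
        (∀ y, |F y| ≤ C * (1 + ‖y.2‖ ^ 2)) →
        (∀ x, ∫ v, F (x, v) * localMaxwellian 1 (θ₀ x) (u₀ x) v = 0) →
        (∀ x (j : Fin 3), ∫ v, F (x, v) * v j * localMaxwellian 1 (θ₀ x) (u₀ x) v = 0) →
        (∀ x, ∫ v, F (x, v) * ‖v‖ ^ 2 * localMaxwellian 1 (θ₀ x) (u₀ x) v = 0) →
        ∀ β : ℝ, |β| ≤ β₀ → ∀ ε : ℝ, 0 < ε → ∃ τ₀ : ℝ, 0 < τ₀ ∧ ∀ τ : ℝ, τ₀ ≤ τ →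
        ∃ N₀ : ℕ, ∀ N : ℕ, N₀ ≤ N →
          ∫⁻ z, ENNReal.ofReal (Real.exp (β * ∑ i : Fin (N + 1),
              (τ * ((N : ℝ) + 1) ^ (-(1 / 3 : ℝ)))⁻¹ *
                ∫ r in (0 : ℝ)..(τ * ((N : ℝ) + 1) ^ (-(1 / 3 : ℝ))), F (((Φ N).flow r z) i)))
            ∂(localGibbsLaw σ a u₀ θ₀ N (Φ N)) ≤
          ENNReal.ofReal (Real.exp (ε * ((N : ℝ) + 1)))) →
    KineticCurrentsWindowLDUniform := fun h =>
  stub_kcwuSharp_implies_rung (kcwuSharp_of_kcwuSharpPlus h)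

end Summit.AtomisticToContinuum.HydrodynamicLimit.Theorems.KineticCurrentsLDAlongFamiliesSketch

end
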